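import Summits.BirchSwinnertonDyer.Rank1Residual.X11b.CastellaErratumThm11Skeleton
import Mathlib.RingTheory.DiscreteValuationRing.Basic
import HarnessLib

/-!
# Lemma 2.2's algebraic content over `Λ_𝒪 = 𝒪⟦T⟧` for ANY complete discrete valuation ring `𝒪`
# (cell `b2b-bsdres`, X11b route R1)

HONEST FRAMING (cell `b2b-bsdres`, run/shared/lean/b2b/bsd-rank1-residual/, verbatim in every
file): the goal of the cell is to DELETE the COMBINATION-SHAPED residual classes of the
Birch–Swinnerton-Dyer formula for ALL analytic-rank `≤ 1` elliptic curves over `ℚ` — "full BSD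
formula for every rank `≤ 1` curve in class `C`" assembled STRICTLY from published theorems — so
that the rank-`≤ 1` remainder becomes exactly the CONSTRUCTION-SHAPED classes, which are TYPED
(missing-input `Prop`s), NOT attempted. This is not "finishing BSD". Sub-cell
`b2b-bsdres-multr1-p1` (X11b via the re-proof of Castella 2018 Thm. A along the author's erratum):
a RESEARCH ROUTE; no claim beyond the stated class; X11b stays CONSTRUCTION-SHAPED; nothing here
changes a label. THEOREMS ONLY (no definition, no named fact, no `sorry`); pure commutative algebra.

`FittingOfNoFiniteSubmodule.lean` proves "no nonzero finite submodule ⇒ `Fitt = Ch`" ([Ski16]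
Prop. 2.3.3 (ii) + § 2.3; the erratum's use of its Lemma 2.2) over the tree's `Λ = ℤ_p⟦T⟧`, i.e.
for `𝒪 = ℤ_p` (Skinner's setting). The erratum works over `Λ_𝒪 = 𝒪⟦Γ⟧` with `𝒪` the ring of
integers of a finite extension of `ℚ_p` (and extends scalars to `Λ_𝒪^{ur}`, an `R₀⟦T⟧`-algebra,
`R₀ = W(𝔽̄_p)`). THIS FILE runs the SAME proof for `𝒪⟦T⟧` over ANY complete discrete valuation
ring `𝒪` (`[IsDiscreteValuationRing 𝒪] [IsAdicComplete 𝔪_𝒪 𝒪]`: finite extensions of `ℤ_p`,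
`R₀`), with a uniformizer `ϖ` in place of `p`: the `M`-regular element is `x_k = T − ϖ^k`
(`PowerSeriesDVR.exists_isSMulRegular_X_sub_C_pow`), `𝒪⟦T⟧/(x_k) ≅ 𝒪` by Weierstrass division,
and the rest (`pd ≤ 1` over a PID, Matsumura § 18 Lemma 2 via the tree's
`hasProjectiveDimensionLE_quotSMulTop_iff`, square presentation) is the ring-generic part of
`FittingOfNoFiniteSubmodule.lean`. Results (namespace `…CongruenceLimit.PowerSeriesDVR`):
`fittingIdeal_zero_isPrincipal_of_forall_length`, `fittingIdeal_zero_eq_charIdeal_of_forall_length`,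
`fittingIdeal_zero_eq_span_of_charIdeal_eq_span_of_forall_length`, and the printed-input END FORM
of the erratum p. 4 skeleton over `Λ_𝒪`, `isTorsion_and_charIdeal_eq_of_congruences_printed`
(any ideal `I ⊆ Jac(Λ_𝒪)`, e.g. `(p)` or `(ϖ)`). Universe: `𝒪, M : Type`.

References: F. Castella, Erratum, Lemma 2.2, Thm. 2.3, proof of Thm. 1.1 (p. 4)
[Castella2018Erratum]; C. Skinner, Pacific J. Math. 283 (2016), § 2.3, § 3.1 [Skinner2016PacificMC];
J. Neukirch, A. Schmidt, K. Wingberg, (5.3.19) [NeukirchSchmidtWingberg2008]; H. Matsumura, § 18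
Lemma 2 [Matsumura1987]; L. Washington, GTM 83, Prop. 7.2 [Washington1997].
-/

noncomputable section

open Literature.RingTheory.FittingIdeal Literature.NumberTheory.EllipticCurves
  Literature.NumberTheory.EllipticCurves.Module Literature.AlgebraicGeometry.Resolution
  CategoryTheory IsLocalRing Polynomial

namespace Summit.BirchSwinnertonDyer.Rank1Residual.X11b.CongruenceLimit.PowerSeriesDVR

variable {𝒪 : Type} [CommRing 𝒪] [IsDomain 𝒪] [IsDiscreteValuationRing 𝒪]
  [IsAdicComplete (maximalIdeal 𝒪) 𝒪] {ϖ : 𝒪}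

/-- The elements `x_k = T − ϖ^k ∈ Λ_𝒪 = 𝒪⟦T⟧` (as coerced polynomials). -/
local notation3 "𝔵[" k "]" =>
  ((Polynomial.X - Polynomial.C (ϖ ^ k) : 𝒪[X]) : PowerSeries 𝒪)

/-! ### The elements `x_k = T − ϖ^k` of `Λ_𝒪 = 𝒪⟦T⟧` -/

omit [IsAdicComplete (maximalIdeal 𝒪) 𝒪] in
/-- `X − ϖ^k` (`k ≥ 1`) is a distinguished polynomial over `𝒪`. [folklore] -/
theorem isDistinguishedAt_X_sub_C_pow (hϖ : Irreducible ϖ) {k : ℕ} (hk : 1 ≤ k) :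
    (X - C (ϖ ^ k) : 𝒪[X]).IsDistinguishedAt (maximalIdeal 𝒪) := by
  refine ⟨⟨fun {i} hi => ?_⟩, monic_X_sub_C _⟩
  rw [natDegree_X_sub_C] at hi
  have hi0 : i = 0 := by omega
  subst hi0
  rw [coeff_sub, coeff_X_zero, coeff_C_zero, zero_sub, neg_mem_iff, mem_maximalIdeal,
    mem_nonunits_iff, isUnit_pow_iff (by omega)]
  exact hϖ.not_isUnit

omit [IsAdicComplete (maximalIdeal 𝒪) 𝒪] in
/-- `x_k ∈ 𝔪_Λ` for `k ≥ 1` (its constant coefficient `−ϖ^k` is not a unit). [folklore] -/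
theorem X_sub_C_pow_mem_maximalIdeal (hϖ : Irreducible ϖ) {k : ℕ} (hk : 1 ≤ k) :
    𝔵[k] ∈ maximalIdeal (PowerSeries 𝒪) := by
  rw [Polynomial.coe_sub, Polynomial.coe_X, Polynomial.coe_C, mem_maximalIdeal, mem_nonunits_iff,
    PowerSeries.isUnit_iff_constantCoeff, map_sub, PowerSeries.constantCoeff_X,
    PowerSeries.constantCoeff_C, zero_sub, IsUnit.neg_iff, isUnit_pow_iff (by omega)]
  exact hϖ.not_isUnit

/-- **Weierstrass division: `Λ_𝒪/(T − ϖ^k) ≅ 𝒪`** (`T ↦ ϖ^k`; Mathlib's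
`Polynomial.IsDistinguishedAt.algEquivQuotient`, `Polynomial.quotientSpanXSubCAlgEquiv`), sending
the class of a polynomial `q` to `q(ϖ^k)`. Stated as an existence to keep the file definition-free.
[cite: Washington1997, Prop. 7.2 (Weierstrass division)] -/
theorem exists_algEquiv_quotient_X_sub_C_pow (hϖ : Irreducible ϖ) {k : ℕ} (hk : 1 ≤ k) :
    ∃ e : (PowerSeries 𝒪 ⧸ Ideal.span {𝔵[k]}) ≃ₐ[𝒪] 𝒪,
      ∀ q : 𝒪[X], e (Ideal.Quotient.mk _ (q : PowerSeries 𝒪)) = q.eval (ϖ ^ k) := by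
  refine ⟨(isDistinguishedAt_X_sub_C_pow hϖ hk).algEquivQuotient.symm.trans
    (quotientSpanXSubCAlgEquiv (ϖ ^ k)), fun q => ?_⟩
  have happly : (isDistinguishedAt_X_sub_C_pow hϖ hk).algEquivQuotient (Ideal.Quotient.mk _ q) =
      Ideal.Quotient.mk _ (q : PowerSeries 𝒪) := rfl
  rw [AlgEquiv.trans_apply, ← happly, AlgEquiv.symm_apply_apply, quotientSpanXSubCAlgEquiv_mk]

/-- `Λ/(x_k)` is a principal ideal domain. [folklore] -/
theorem isPrincipalIdealRing_quotient (hϖ : Irreducible ϖ) {k : ℕ} (hk : 1 ≤ k) :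
    IsPrincipalIdealRing (PowerSeries 𝒪 ⧸ Ideal.span {𝔵[k]}) := by
  obtain ⟨e, -⟩ := exists_algEquiv_quotient_X_sub_C_pow hϖ hk
  exact IsPrincipalIdealRing.of_surjective e.symm.toRingEquiv.toRingHom e.symm.surjective

/-- `Λ/(x_k)` is a domain (so `(x_k)` is prime). [folklore] -/
theorem isDomain_quotient (hϖ : Irreducible ϖ) {k : ℕ} (hk : 1 ≤ k) : IsDomain (PowerSeries 𝒪 ⧸ Ideal.span {𝔵[k]}) := by
  obtain ⟨e, -⟩ := exists_algEquiv_quotient_X_sub_C_pow hϖ hk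
  exact e.toMulEquiv.isDomain

/-- The ideals `(x_k)`, `k ≥ 1`, are pairwise distinct: `x_k ∈ (x_j)` forces `j = k`
(evaluate at `T = p^j`). [folklore] -/
theorem eq_of_X_sub_C_pow_mem_span (hϖ : Irreducible ϖ) {j k : ℕ} (hj : 1 ≤ j)
    (h : 𝔵[k] ∈ Ideal.span {𝔵[j]}) :
    j = k := by
  obtain ⟨e, he⟩ := exists_algEquiv_quotient_X_sub_C_pow hϖ hj
  have h0 : Ideal.Quotient.mk (Ideal.span {𝔵[j]}) 𝔵[k] = 0 := Ideal.Quotient.eq_zero_iff_mem.mpr h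
  have h1 := he (X - C (ϖ ^ k))
  rw [h0, map_zero, eval_sub, eval_X, eval_C, eq_comm, sub_eq_zero] at h1
  exact pow_injective_of_not_isUnit hϖ.not_isUnit
    hϖ.ne_zero h1

/-- A prime `𝔮 ≠ 𝔪` of `Λ_𝒪` containing `x_k` is `(x_k)`: in the PID `Λ_𝒪/(x_k) ≅ 𝒪` the image of
`𝔮` is a prime, hence `0` or maximal, and the latter would make `𝔮` maximal. [folklore] -/
theorem eq_span_of_mem_of_ne_maximalIdeal (hϖ : Irreducible ϖ) {k : ℕ} (hk : 1 ≤ k) {𝔮 : Ideal (PowerSeries 𝒪)}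
    [𝔮.IsPrime] (hx : 𝔵[k] ∈ 𝔮) (hne : 𝔮 ≠ maximalIdeal (PowerSeries 𝒪)) :
    𝔮 = Ideal.span {𝔵[k]} := by
  haveI := isPrincipalIdealRing_quotient hϖ hk
  haveI := isDomain_quotient hϖ hk
  set I : Ideal (PowerSeries 𝒪) := Ideal.span {𝔵[k]} with hI
  have hle : I ≤ 𝔮 := (Ideal.span_singleton_le_iff_mem _).mpr hx
  have hker : RingHom.ker (Ideal.Quotient.mk I) ≤ 𝔮 := by rw [Ideal.mk_ker]; exact hle
  haveI hprime : (𝔮.map (Ideal.Quotient.mk I)).IsPrime :=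
    Ideal.map_isPrime_of_surjective Ideal.Quotient.mk_surjective hker
  by_cases hbot : 𝔮.map (Ideal.Quotient.mk I) = ⊥
  · rw [Ideal.map_eq_bot_iff_le_ker, Ideal.mk_ker] at hbot
    exact le_antisymm hbot hle
  · exfalso
    have hmax : (𝔮.map (Ideal.Quotient.mk I)).IsMaximal := IsPrime.to_maximal_ideal hbot
    have hcomap := Ideal.comap_isMaximal_of_surjective (Ideal.Quotient.mk I)
      Ideal.Quotient.mk_surjective (K := 𝔮.map (Ideal.Quotient.mk I))
    rw [Ideal.comap_map_of_surjective _ Ideal.Quotient.mk_surjective, ← RingHom.ker_eq_comap_bot,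
      sup_eq_left.mpr hker] at hcomap
    exact hne (IsLocalRing.eq_maximalIdeal hcomap)

/-! ### A regular element of the form `T − ϖ^k` -/

/-- **An `M`-regular element `x_k = T − ϖ^k`.** If every submodule of finite length of the finite
`Λ_𝒪`-module `M` is zero, then `𝔪 ∉ Ass(M)` (an embedding `Λ/𝔪 ↪ M` has image of length `1`), every
associated prime containing some `x_k` is `(x_k)`, these are pairwise distinct, `Ass(M)` is finite
(`associatedPrimes.finite`) and its union is the set of zero-divisors on `M`
(`biUnion_associatedPrimes_eq_zero_divisors`); so some `x_k`, `k ≥ 1`, is `M`-regular.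
[cite: Matsumura1987, Thm. 6.1 (ii) and Thm. 6.5 (i) (zero-divisors = union of the finitely many associated primes)] -/
theorem exists_isSMulRegular_X_sub_C_pow (hϖ : Irreducible ϖ) (M : Type*) [AddCommGroup M]
    [Module (PowerSeries 𝒪) M] [Module.Finite (PowerSeries 𝒪) M]
    (hM : ∀ N : Submodule (PowerSeries 𝒪) M, Module.length (PowerSeries 𝒪) N ≠ ⊤ → N = ⊥) :
    ∃ k : ℕ, 1 ≤ k ∧ IsSMulRegular M 𝔵[k] := by
  classical
  set Λ := PowerSeries 𝒪
  -- `𝔪` is not an associated prime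
  have hmax : maximalIdeal Λ ∉ associatedPrimes Λ M := by
    intro hmem
    rw [AssociatedPrimes.mem_iff, isAssociatedPrime_iff_exists_injective_linearMap] at hmem
    obtain ⟨-, f, hf⟩ := hmem
    haveI : IsSimpleModule Λ (Λ ⧸ maximalIdeal Λ) :=
      isSimpleModule_iff_isCoatom.mpr (maximalIdeal.isMaximal Λ).out
    have hlen : Module.length Λ (LinearMap.range f) = 1 := by
      rw [← (LinearEquiv.ofInjective f hf).length_eq]
      exact Module.length_eq_one _ _
    have hbot := hM (LinearMap.range f) (by rw [hlen]; exact ENat.one_ne_top)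
    have h1 : f 1 ∈ LinearMap.range f := LinearMap.mem_range_self f 1
    rw [hbot, Submodule.mem_bot] at h1
    exact one_ne_zero (hf (by rw [h1, map_zero]))
  -- the bad exponents inject into the finite set of associated primes
  have hfin := associatedPrimes.finite Λ M
  set bad : Set ℕ := {k | 1 ≤ k ∧ ¬ IsSMulRegular M 𝔵[k]} with hbad
  have hmem : ∀ k ∈ bad, Ideal.span {𝔵[k]} ∈ associatedPrimes Λ M := by
    rintro k ⟨hk, hreg⟩
    rw [isSMulRegular_iff_right_eq_zero_of_smul] at hreg
    push Not at hreg
    obtain ⟨m, hm, hm0⟩ := hreg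
    have hzd : (𝔵[k] : Λ) ∈ {r : Λ | ∃ x : M, x ≠ 0 ∧ r • x = 0} := ⟨m, hm0, hm⟩
    rw [← biUnion_associatedPrimes_eq_zero_divisors] at hzd
    obtain ⟨𝔮, h𝔮, hx⟩ := Set.mem_iUnion₂.mp hzd
    haveI := (AssociatedPrimes.mem_iff.mp h𝔮).isPrime
    have hne : 𝔮 ≠ maximalIdeal Λ := fun h => hmax (h ▸ h𝔮)
    rwa [eq_span_of_mem_of_ne_maximalIdeal hϖ hk hx hne] at h𝔮
  have hinj : Set.InjOn (fun k : ℕ => Ideal.span {𝔵[k]}) bad := by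
    rintro j ⟨hj, -⟩ k ⟨-, -⟩ hjk
    have hjk' : Ideal.span {𝔵[j]} = Ideal.span {𝔵[k]} := hjk
    exact eq_of_X_sub_C_pow_mem_span hϖ hj (by rw [hjk']; exact Ideal.mem_span_singleton_self _)
  have hbadfin : bad.Finite :=
    Set.Finite.of_finite_image (hfin.subset (by rintro _ ⟨k, hk, rfl⟩; exact hmem k hk)) hinj
  -- pick a good exponent
  obtain ⟨k, hk1, hkbad⟩ : ((Set.Ici 1 : Set ℕ) \ bad).Nonempty :=
    ((Set.Ici_infinite 1).sdiff hbadfin).nonempty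
  refine ⟨k, hk1, ?_⟩
  by_contra hreg
  exact hkbad ⟨hk1, hreg⟩

/-! ### Projective dimension `≤ 1` -/

/-- **`pd_Λ M ≤ 1` for a finite `Λ_𝒪`-module with no nonzero submodule of finite length**
([NSW] (5.3.19) (i), direction ⇒): with the `M`-regular `x_k = T − ϖ^k ∈ 𝔪` of
`exists_isSMulRegular_X_sub_C_pow`, `Λ_𝒪/(x_k) ≅ 𝒪` is a PID so `pd_{Λ/x_k}(M/x_kM) ≤ 1`, and
Matsumura § 18 Lemma 2 (`hasProjectiveDimensionLE_quotSMulTop_iff`) transfers this to `Λ`.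
[cite: NeukirchSchmidtWingberg2008, (5.3.19) (i)] [cite: Matsumura1987, §18 Lemma 2] -/
theorem hasProjectiveDimensionLE_one_of_forall_length' (hϖ : Irreducible ϖ) (M : Type) [AddCommGroup M]
    [Module (PowerSeries 𝒪) M] [Module.Finite (PowerSeries 𝒪) M]
    (hM : ∀ N : Submodule (PowerSeries 𝒪) M, Module.length (PowerSeries 𝒪) N ≠ ⊤ → N = ⊥) :
    HasProjectiveDimensionLE (ModuleCat.of (PowerSeries 𝒪) M) 1 := by
  obtain ⟨k, hk, hreg⟩ := exists_isSMulRegular_X_sub_C_pow hϖ M hM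
  have reg1 : IsSMulRegular (PowerSeries 𝒪) 𝔵[k] :=
    (IsRegular.of_ne_zero (fun h => (monic_X_sub_C (ϖ ^ k)).ne_zero
      (Polynomial.coe_eq_zero_iff.mp h))).left.isSMulRegular
  haveI := isPrincipalIdealRing_quotient hϖ hk
  haveI := isDomain_quotient hϖ hk
  haveI : Module.Finite (PowerSeries 𝒪 ⧸ Ideal.span {𝔵[k]})
      (QuotSMulTop 𝔵[k] (ModuleCat.of (PowerSeries 𝒪) M)) :=
    Module.Finite.of_restrictScalars_finite (PowerSeries 𝒪) _ _
  exact (hasProjectiveDimensionLE_quotSMulTop_iff (ModuleCat.of (PowerSeries 𝒪) M) 𝔵[k] reg1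
    hreg (X_sub_C_pow_mem_maximalIdeal hϖ hk) 1).mpr
    (hasProjectiveDimensionLE_one_of_isPrincipalIdealRing
      (QuotSMulTop 𝔵[k] (ModuleCat.of (PowerSeries 𝒪) M)))

/-- **Lemma 2.2's algebraic content** ([Ski16] § 2.3 Lemma / (f); [NSW] (5.3.19)): a finite
TORSION `Λ_𝒪`-module with no nonzero submodule of finite length has PRINCIPAL order ideal.
[cite: Skinner2016PacificMC, §2.3 (Lemma `F^Σ_L(f) = Ch^Σ_L(f)`) and §3.1 (f)]
[cite: NeukirchSchmidtWingberg2008, (5.3.19)] -/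
theorem fittingIdeal_zero_isPrincipal_of_forall_length (M : Type) [AddCommGroup M]
    [Module (PowerSeries 𝒪) M] [Module.Finite (PowerSeries 𝒪) M]
    (htors : Module.IsTorsion (PowerSeries 𝒪) M)
    (hM : ∀ N : Submodule (PowerSeries 𝒪) M, Module.length (PowerSeries 𝒪) N ≠ ⊤ → N = ⊥) :
    (Module.fittingIdeal (PowerSeries 𝒪) M 0).IsPrincipal :=
by
  obtain ⟨ϖ, hϖ⟩ := IsDiscreteValuationRing.exists_irreducible 𝒪
  exact fittingIdeal_zero_isPrincipal_of_hasProjectiveDimensionLE_one M htors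
    (hasProjectiveDimensionLE_one_of_forall_length' hϖ M hM)

/-- **`Fitt_Λ(M) = char_Λ(M)` for a finite torsion `Λ_𝒪`-module with no nonzero submodule of finite
length** — the statement "`Ch = Fitt`" that the erratum takes from its Lemma 2.2 and [Ski16] from
Prop. 2.3.3 (ii), proved for `Λ_𝒪 = 𝒪⟦T⟧`, `𝒪` any complete discrete valuation ring.
[cite: Castella2018Erratum, proof of Thm. 1.1 (p. 4), "by Lemma 2.2 we know that Ch = Fitt"]
[cite: Skinner2016PacificMC, §2.3 (Lemma `F^Σ_L(f) = Ch^Σ_L(f)`)] -/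
theorem fittingIdeal_zero_eq_charIdeal_of_forall_length (M : Type) [AddCommGroup M]
    [Module (PowerSeries 𝒪) M] [Module.Finite (PowerSeries 𝒪) M]
    (htors : Module.IsTorsion (PowerSeries 𝒪) M)
    (hM : ∀ N : Submodule (PowerSeries 𝒪) M, Module.length (PowerSeries 𝒪) N ≠ ⊤ → N = ⊥) :
    Module.fittingIdeal (PowerSeries 𝒪) M 0 = charIdeal (PowerSeries 𝒪) M :=
  (fittingIdeal_zero_eq_charIdeal_iff_isPrincipal htors).mpr
    (fittingIdeal_zero_isPrincipal_of_forall_length M htors hM)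

/-- **Hypothesis `hF` of the congruence skeleton in its printed form**: for a finite torsion
`Λ_𝒪`-module `N` (`X^Σ_ac(A_{g_m})`) with no nonzero submodule of finite length (Lemma 2.2) and
`char_Λ(N) = (L)` (Thm. 2.3 for `g_m`), `Fitt_Λ(N) = (L)`.
[cite: Castella2018Erratum, proof of Thm. 1.1 (p. 4)] -/
theorem fittingIdeal_zero_eq_span_of_charIdeal_eq_span_of_forall_length (N : Type) [AddCommGroup N]
    [Module (PowerSeries 𝒪) N] [Module.Finite (PowerSeries 𝒪) N]
    (htors : Module.IsTorsion (PowerSeries 𝒪) N)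
    (hN : ∀ N' : Submodule (PowerSeries 𝒪) N, Module.length (PowerSeries 𝒪) N' ≠ ⊤ → N' = ⊥)
    {L : PowerSeries 𝒪} (hCh : charIdeal (PowerSeries 𝒪) N = Ideal.span {L}) :
    Module.fittingIdeal (PowerSeries 𝒪) N 0 = Ideal.span {L} := by
  rw [fittingIdeal_zero_eq_charIdeal_of_forall_length N htors hN, hCh]


/-- **Erratum Thm. 1.1 ⇐ Thm. 2.3, printed inputs, kernel form over `Λ_𝒪 = 𝒪⟦T⟧`** for any
complete discrete valuation ring `𝒪` and any ideal `I ⊆ Jac(Λ_𝒪)` (`(p)`, `(ϖ)`): from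
`e` [(b)+Lemma 2.1: `M/I^m ≅ N_m/I^m`], `hT`+`hCh` [Thm. 2.3 for `g_m`: `N_m` torsion,
`char(N_m) = (L_m)`], `hnf` [Lemma 2.2: no nonzero finite-length submodule of `N_m`],
`hc` [(c): `(L_m) + I^m = (L) + I^m`], `L ≠ 0` [CV07 + Cas20 Thm. 5.3]: `M` is torsion and
`Fitt_{Λ_𝒪}(M) = char_{Λ_𝒪}(M) = (L)` — Thm. 1.1 for `Σ` over `Λ_𝒪`.
[cite: Castella2018Erratum, proof of Thm. 1.1 (p. 4)] [cite: Skinner2016PacificMC, §3.1 (p. 192)] -/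
theorem isTorsion_and_charIdeal_eq_of_congruences_printed
    {M : Type} [AddCommGroup M] [Module (PowerSeries 𝒪) M] [Module.Finite (PowerSeries 𝒪) M]
    (N : ℕ → Type) [∀ m, AddCommGroup (N m)] [∀ m, Module (PowerSeries 𝒪) (N m)]
    [∀ m, Module.Finite (PowerSeries 𝒪) (N m)]
    (I : Ideal (PowerSeries 𝒪)) (hI : I ≤ (⊥ : Ideal (PowerSeries 𝒪)).jacobson)
    {L : PowerSeries 𝒪} (hL : L ≠ 0) (Lm : ℕ → PowerSeries 𝒪)
    (e : ∀ m : ℕ, 1 ≤ m →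
      ((M ⧸ (I ^ m • (⊤ : Submodule (PowerSeries 𝒪) M))) ≃ₗ[PowerSeries 𝒪]
        (N m ⧸ (I ^ m • (⊤ : Submodule (PowerSeries 𝒪) (N m))))))
    (hT : ∀ m : ℕ, 1 ≤ m → Module.IsTorsion (PowerSeries 𝒪) (N m))
    (hCh : ∀ m : ℕ, 1 ≤ m → charIdeal (PowerSeries 𝒪) (N m) = Ideal.span {Lm m})
    (hnf : ∀ m : ℕ, 1 ≤ m → ∀ N' : Submodule (PowerSeries 𝒪) (N m),
      Module.length (PowerSeries 𝒪) N' ≠ ⊤ → N' = ⊥)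
    (hc : ∀ m : ℕ, 1 ≤ m → Ideal.span {Lm m} ⊔ I ^ m = Ideal.span {L} ⊔ I ^ m) :
    Module.IsTorsion (PowerSeries 𝒪) M ∧
      Module.fittingIdeal (PowerSeries 𝒪) M 0 = Ideal.span {L} ∧
      charIdeal (PowerSeries 𝒪) M = Ideal.span {L} :=
  isTorsion_and_charIdeal_eq_of_congruences N I hI hL Lm e
    (fun m hm => fittingIdeal_zero_eq_span_of_charIdeal_eq_span_of_forall_length (N m)
      (hT m hm) (hnf m hm) (hCh m hm))
    hc

end Summit.BirchSwinnertonDyer.Rank1Residual.X11b.CongruenceLimit.PowerSeriesDVR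

end
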